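import Mathlib.NumberTheory.NumberField.CanonicalEmbedding.Basic
import Mathlib.Analysis.Calculus.FDeriv.Mul
import Mathlib.Analysis.Calculus.ContDiff.Operations
import HarnessLib

/-!
# Moment kernels on `K_∞ = K ⊗_ℚ ℝ`: smooth compactly supported kernels built by place-pure derivatives

Topic `NumberTheory/Automorphic`; namespace `Literature.NumberTheory.Automorphic`. Definitions with
bodies and theorems (no named fact). On the mixed space `K_∞ = ℝ^{r₁} × ℂ^{r₂}` of a number field `K`
(Mathlib `NumberField.mixedEmbedding.mixedSpace K`, real basis `stdBasis K` indexed by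
`index K = {w real} ⊕ ({w complex} × Fin 2)`) we introduce the class of real kernels used to smooth
along the archimedean unipotent line in the Kirillov `L²`-bound (Jacquet–Shalika (1981), §4):

* `indexPlace b` — the infinite place carrying the real coordinate `b`; `IsPureDir w c` — the vector
  `c ∈ K_∞` is supported at the single place `w` (all its real coordinates at the other places
  vanish); `isPureDir_stdBasis`;
* `IsMomentKernel k g` (inductive), `k : InfinitePlace K → ℕ` — `g : K_∞ → ℝ` is obtained from `C^∞`
  compactly supported functions by directional derivatives along place-pure directions, finite
  `ℝ`-linear combinations and weakening, with AT LEAST `k w` derivatives along directions at the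
  place `w` in every term. (On the Fourier side — a later file — such a kernel has a transform
  vanishing to order `k w` along the hyperplane `{ξ_w = 0}`, which is what the dilation integral of
  the Kirillov bound needs; here only the algebra is done.)
* closure: `IsMomentKernel.contDiff`, `.hasCompactSupport`, `.neg`, `.sub`, `.sum`,
  `.fderiv_dir` — **any directional derivative stays in the class** (expand the direction in
  `stdBasis K`), and `.coord_mul` — **multiplying by a real coordinate `x_b` costs one derivative at
  the place of `b`** (Leibniz: `x_b ∂_c g = ∂_c (x_b g) - (∂_c x_b) g`, and `∂_c x_b = 0` unless `c`
  lives at the place of `b`);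
* `IsMomentKernelGE M g` — the class with at least `M` derivatives at every place, and its closure
  lemmas (`coord_mul` lowers `M` by one, `fderiv_dir` keeps it).

## References

* H. Jacquet, J. A. Shalika, *On Euler products and the classification of automorphic
  representations I*, Amer. J. Math. 103 (1981), §4 [JacquetShalikaAJM1981].
* G. B. Folland, *A Course in Abstract Harmonic Analysis* (1995), §4.2 [Folland1995].
-/

noncomputable section

open scoped Classical ContDiff
open NumberField NumberField.mixedEmbedding NumberField.InfinitePlace

namespace Literature.NumberTheory.Automorphic

variable (K : Type) [Field K] [NumberField K]

/-! ### Coordinates and place-pure directions -/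

/-- The infinite place carrying the real coordinate `b ∈ index K` of `K_∞`. [folklore] -/
def indexPlace : index K → InfinitePlace K
  | Sum.inl w => w.1
  | Sum.inr p => p.1.1

/-- The real coordinate `x ↦ x_b` of `K_∞` as a continuous linear form. [folklore] -/
def coordCLM (b : index K) : mixedSpace K →L[ℝ] ℝ :=
  ⟨(stdBasis K).coord b, LinearMap.continuous_of_finiteDimensional _⟩

/-- Unfolding of `coordCLM`. [folklore] -/
@[simp]
theorem coordCLM_apply (b : index K) (x : mixedSpace K) : coordCLM K b x = (stdBasis K).repr x b := rfl

/-- `c ∈ K_∞` is supported at the single infinite place `w`: its real coordinates at all other places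
vanish. [folklore] -/
def IsPureDir (w : InfinitePlace K) (c : mixedSpace K) : Prop :=
  ∀ b : index K, indexPlace K b ≠ w → (stdBasis K).repr c b = 0

/-- The basis vector `stdBasis K b` is supported at the place of `b`. [folklore] -/
theorem isPureDir_stdBasis (b : index K) : IsPureDir K (indexPlace K b) (stdBasis K b) := by
  intro b' hb'
  rw [(stdBasis K).repr_self, Finsupp.single_apply, if_neg]
  rintro rfl
  exact hb' rfl

/-- **The real coordinates are dominated by the place norms**: `|x_b| ≤ |x|_{w(b)}`. [folklore] -/
theorem abs_repr_le_normAtPlace (x : mixedSpace K) (b : index K) :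
    |(stdBasis K).repr x b| ≤ normAtPlace (indexPlace K b) x := by
  rcases b with w | ⟨w, i⟩
  · rw [stdBasis_apply_isReal, indexPlace, normAtPlace_apply_of_isReal w.2, Real.norm_eq_abs]
  · match i with
    | 0 =>
      rw [stdBasis_apply_isComplex_fst, indexPlace, normAtPlace_apply_of_isComplex w.2]
      exact Complex.abs_re_le_norm _
    | 1 =>
      rw [stdBasis_apply_isComplex_snd, indexPlace, normAtPlace_apply_of_isComplex w.2]
      exact Complex.abs_im_le_norm _

/-- The place norms are dominated by the (sup) norm of `K_∞`. [folklore] -/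
theorem normAtPlace_le_norm (w : InfinitePlace K) (x : mixedSpace K) : normAtPlace w x ≤ ‖x‖ := by
  rw [norm_eq_sup'_normAtPlace]
  exact Finset.le_sup' (fun w => normAtPlace w x) (Finset.mem_univ w)

/-- `0` is supported at every place. [folklore] -/
theorem isPureDir_zero (w : InfinitePlace K) : IsPureDir K w 0 := fun b _ => by simp

/-- Place-pure vectors at `w` form a subspace: sums. [folklore] -/
theorem IsPureDir.add {w : InfinitePlace K} {c c' : mixedSpace K} (hc : IsPureDir K w c) (hc' : IsPureDir K w c') :
    IsPureDir K w (c + c') := fun b hb => by simp [hc b hb, hc' b hb]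

/-- Place-pure vectors at `w` form a subspace: scalar multiples. [folklore] -/
theorem IsPureDir.smul {w : InfinitePlace K} {c : mixedSpace K} (hc : IsPureDir K w c) (a : ℝ) :
    IsPureDir K w (a • c) := fun b hb => by simp [hc b hb]

/-! ### The class of moment kernels -/

/-- **Moment kernels with at least `k w` place-pure derivatives at each place `w`.** Generated from
`C^∞` compactly supported real functions on `K_∞` (`base`, exponent `0`) by directional derivatives
along place-pure directions (`deriv`, raising the exponent at that place by one), the zero kernel,
sums, real scalar multiples, and weakening of the exponent (`mono`). [cite: JacquetShalikaAJM1981, §4] -/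
inductive IsMomentKernel : (InfinitePlace K → ℕ) → (mixedSpace K → ℝ) → Prop
  | base {h : mixedSpace K → ℝ} (hs : ContDiff ℝ ∞ h) (hc : HasCompactSupport h) : IsMomentKernel 0 h
  | deriv {k : InfinitePlace K → ℕ} {g : mixedSpace K → ℝ} (w : InfinitePlace K) {c : mixedSpace K}
      (hc : IsPureDir K w c) (hg : IsMomentKernel k g) :
      IsMomentKernel (k + Pi.single w 1) (fun x => fderiv ℝ g x c)
  | zero (k : InfinitePlace K → ℕ) : IsMomentKernel k 0
  | add {k : InfinitePlace K → ℕ} {g g' : mixedSpace K → ℝ} (hg : IsMomentKernel k g) (hg' : IsMomentKernel k g') :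
      IsMomentKernel k (g + g')
  | smul {k : InfinitePlace K → ℕ} {g : mixedSpace K → ℝ} (a : ℝ) (hg : IsMomentKernel k g) :
      IsMomentKernel k (a • g)
  | mono {k k' : InfinitePlace K → ℕ} {g : mixedSpace K → ℝ} (hk : k' ≤ k) (hg : IsMomentKernel k g) :
      IsMomentKernel k' g

variable {K}

namespace IsMomentKernel

/-- A moment kernel is `C^∞`. [folklore] -/
theorem contDiff {k : InfinitePlace K → ℕ} {g : mixedSpace K → ℝ} (hg : IsMomentKernel K k g) : ContDiff ℝ ∞ g := by
  induction hg with
  | base hs _ => exact hs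
  | deriv w _ _ ih => exact (ih.fderiv_right le_rfl).clm_apply contDiff_const
  | zero k => exact contDiff_const
  | add _ _ ih ih' => exact ih.add ih'
  | smul a _ ih => exact contDiff_const.smul ih
  | mono _ _ ih => exact ih

/-- A moment kernel has compact support. [folklore] -/
theorem hasCompactSupport {k : InfinitePlace K → ℕ} {g : mixedSpace K → ℝ} (hg : IsMomentKernel K k g) :
    HasCompactSupport g := by
  induction hg with
  | base _ hc => exact hc
  | @deriv k g w c _ _ ih =>
    refine (ih.fderiv (𝕜 := ℝ)).mono ?_
    intro x hx
    rw [Function.mem_support] at hx ⊢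
    intro h0
    exact hx (by rw [h0]; rfl)
  | zero k => exact HasCompactSupport.zero
  | add _ _ ih ih' => exact ih.add ih'
  | smul a _ ih => exact ih.smul_left
  | mono _ _ ih => exact ih

/-- A moment kernel is continuous. [folklore] -/
theorem continuous {k : InfinitePlace K → ℕ} {g : mixedSpace K → ℝ} (hg : IsMomentKernel K k g) : Continuous g :=
  hg.contDiff.continuous

/-- A moment kernel is differentiable. [folklore] -/
theorem differentiable {k : InfinitePlace K → ℕ} {g : mixedSpace K → ℝ} (hg : IsMomentKernel K k g) :
    Differentiable ℝ g :=
  hg.contDiff.differentiable (by simp)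

/-- Negation. [folklore] -/
theorem neg {k : InfinitePlace K → ℕ} {g : mixedSpace K → ℝ} (hg : IsMomentKernel K k g) : IsMomentKernel K k (-g) := by
  simpa using hg.smul (-1)

/-- Differences. [folklore] -/
theorem sub {k : InfinitePlace K → ℕ} {g g' : mixedSpace K → ℝ} (hg : IsMomentKernel K k g) (hg' : IsMomentKernel K k g') :
    IsMomentKernel K k (g - g') := by
  simpa [sub_eq_add_neg] using hg.add hg'.neg

/-- Finite sums. [folklore] -/
theorem sum {k : InfinitePlace K → ℕ} {ι' : Type*} (s : Finset ι') {g : ι' → mixedSpace K → ℝ}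
    (hg : ∀ i ∈ s, IsMomentKernel K k (g i)) : IsMomentKernel K k (∑ i ∈ s, g i) := by
  induction s using Finset.induction_on with
  | empty => simpa using IsMomentKernel.zero k
  | insert i s hi ih =>
    rw [Finset.sum_insert hi]
    exact (hg i (Finset.mem_insert_self i s)).add (ih fun j hj => hg j (Finset.mem_insert_of_mem hj))

/-- **Directional derivatives stay in the class** (in any direction `c ∈ K_∞`: expand `c` in the real
basis, whose vectors are place-pure). [folklore] -/
theorem fderiv_dir {k : InfinitePlace K → ℕ} {g : mixedSpace K → ℝ} (hg : IsMomentKernel K k g) (c : mixedSpace K) :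
    IsMomentKernel K k (fun x => fderiv ℝ g x c) := by
  have hexp : (fun x => fderiv ℝ g x c) = ∑ b, (stdBasis K).repr c b • fun x => fderiv ℝ g x (stdBasis K b) := by
    funext x
    conv_lhs => rw [← (stdBasis K).sum_repr c]
    simp only [map_sum, map_smul, Finset.sum_apply, Pi.smul_apply, smul_eq_mul]
  rw [hexp]
  refine IsMomentKernel.sum _ fun b _ => IsMomentKernel.smul _ ?_
  exact IsMomentKernel.mono (k := k + Pi.single (indexPlace K b) 1) (le_add_of_nonneg_right (fun _ => Nat.zero_le _))
    (hg.deriv (indexPlace K b) (isPureDir_stdBasis K b))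

/-- The Leibniz rule for a coordinate times a kernel, in a fixed direction:
`∂_c (x_b g) = x_b ∂_c g + (c_b) g`. [folklore] -/
theorem fderiv_coord_mul_apply {g : mixedSpace K → ℝ} (hg : Differentiable ℝ g) (b : index K) (x c : mixedSpace K) :
    fderiv ℝ (fun x => (stdBasis K).repr x b * g x) x c =
      (stdBasis K).repr x b * fderiv ℝ g x c + (stdBasis K).repr c b * g x := by
  have hL : HasFDerivAt (fun x => (stdBasis K).repr x b) (coordCLM K b) x := (coordCLM K b).hasFDerivAt
  have h := hL.mul (hg x).hasFDerivAt
  change fderiv ℝ ((fun x => (stdBasis K).repr x b) * g) x c = _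
  rw [h.fderiv]
  simp only [add_apply, FunLike.coe_smul, Pi.smul_apply, smul_eq_mul, coordCLM_apply]
  ring

omit [NumberField K] in
/-- Exponent bookkeeping for `coord_mul`, the case of a derivative at another place or of positive
order. [folklore] -/
private theorem update_le_update_add_single (k : InfinitePlace K → ℕ) (w w' : InfinitePlace K) :
    Function.update (k + Pi.single w' 1 : InfinitePlace K → ℕ) w ((k + Pi.single w' 1 : InfinitePlace K → ℕ) w - 1) ≤
      Function.update k w (k w - 1) + (Pi.single w' 1 : InfinitePlace K → ℕ) := by
  intro v
  simp only [Pi.add_apply]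
  by_cases hv : v = w
  · subst hv
    simp only [Function.update_self]
    by_cases hw : v = w'
    · subst hw; simp only [Pi.single_eq_same]; omega
    · simp [Pi.single_eq_of_ne hw]
  · simp [Function.update_of_ne hv]

/-- **Multiplying by a real coordinate costs one derivative at its place**: if `g` has at least `k w`
pure derivatives at each `w`, then `x_b · g` has at least `k w - [w = place of b]`. [folklore] -/
theorem coord_mul {k : InfinitePlace K → ℕ} {g : mixedSpace K → ℝ} (hg : IsMomentKernel K k g) (b : index K) :
    IsMomentKernel K (Function.update k (indexPlace K b) (k (indexPlace K b) - 1))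
      (fun x => (stdBasis K).repr x b * g x) := by
  induction hg with
  | @base h hs hc =>
    have h0 : Function.update (0 : InfinitePlace K → ℕ) (indexPlace K b) ((0 : InfinitePlace K → ℕ) (indexPlace K b) - 1) = 0 := by
      ext v; by_cases hv : v = indexPlace K b <;> simp [hv]
    rw [h0]
    exact IsMomentKernel.base ((coordCLM K b).contDiff.mul hs) hc.mul_left
  | @deriv k g w' c hc hg ih =>
    -- Leibniz: `x_b ∂_c g = ∂_c (x_b g) - c_b g`
    have hfun : (fun x => (stdBasis K).repr x b * fderiv ℝ g x c) =
        (fun x => fderiv ℝ (fun x => (stdBasis K).repr x b * g x) x c) + (-((stdBasis K).repr c b)) • g := by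
      funext x
      simp only [Pi.add_apply, Pi.smul_apply, smul_eq_mul, fderiv_coord_mul_apply hg.differentiable]
      ring
    rw [hfun]
    refine IsMomentKernel.add ?_ ?_
    · exact IsMomentKernel.mono (update_le_update_add_single k (indexPlace K b) w') (ih.deriv w' hc)
    · by_cases hb : indexPlace K b = w'
      · -- same place: the exponent is unchanged there
        have hle : Function.update (k + Pi.single w' 1 : InfinitePlace K → ℕ) (indexPlace K b)
            ((k + Pi.single w' 1 : InfinitePlace K → ℕ) (indexPlace K b) - 1) ≤ k := by
          intro v
          by_cases hv : v = indexPlace K b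
          · subst hv; simp [hb]
          · rw [Function.update_of_ne hv, Pi.add_apply, Pi.single_eq_of_ne (fun h => hv (h.trans hb.symm)), add_zero]
        exact IsMomentKernel.mono hle (hg.smul _)
      · -- other place: `c_b = 0`
        rw [hc b hb, neg_zero, zero_smul]
        exact IsMomentKernel.zero _
  | zero k =>
    have : (fun x => (stdBasis K).repr x b * (0 : mixedSpace K → ℝ) x) = 0 := by funext x; simp
    rw [this]
    exact IsMomentKernel.zero _
  | @add k g g' _ _ ih ih' =>
    have : (fun x => (stdBasis K).repr x b * (g + g') x) =
        (fun x => (stdBasis K).repr x b * g x) + fun x => (stdBasis K).repr x b * g' x := by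
      funext x; simp only [Pi.add_apply]; ring
    rw [this]
    exact ih.add ih'
  | @smul k g a _ ih =>
    have : (fun x => (stdBasis K).repr x b * (a • g) x) = a • fun x => (stdBasis K).repr x b * g x := by
      funext x; simp only [Pi.smul_apply, smul_eq_mul]; ring
    rw [this]
    exact ih.smul a
  | @mono k k' g hk _ ih =>
    refine IsMomentKernel.mono (fun v => ?_) ih
    by_cases hv : v = indexPlace K b
    · subst hv; simpa using Nat.sub_le_sub_right (hk _) 1
    · simpa [Function.update_of_ne hv] using hk v

end IsMomentKernel

/-! ### The class with at least `M` derivatives at every place -/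

variable (K) in
/-- Moment kernels with at least `M` place-pure derivatives at EVERY infinite place. [folklore] -/
def IsMomentKernelGE (M : ℕ) (g : mixedSpace K → ℝ) : Prop :=
  ∃ k : InfinitePlace K → ℕ, (∀ w, M ≤ k w) ∧ IsMomentKernel K k g

namespace IsMomentKernelGE

/-- A `C^∞` compactly supported function is a moment kernel of order `0`. [folklore] -/
theorem of_contDiff {h : mixedSpace K → ℝ} (hs : ContDiff ℝ ∞ h) (hc : HasCompactSupport h) : IsMomentKernelGE K 0 h :=
  ⟨0, fun _ => le_rfl, IsMomentKernel.base hs hc⟩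

/-- Smoothness. [folklore] -/
theorem contDiff {M : ℕ} {g : mixedSpace K → ℝ} (hg : IsMomentKernelGE K M g) : ContDiff ℝ ∞ g := by
  obtain ⟨_, _, hgk⟩ := hg
  exact hgk.contDiff

/-- Compact support. [folklore] -/
theorem hasCompactSupport {M : ℕ} {g : mixedSpace K → ℝ} (hg : IsMomentKernelGE K M g) : HasCompactSupport g := by
  obtain ⟨_, _, hgk⟩ := hg
  exact hgk.hasCompactSupport

/-- Continuity. [folklore] -/
theorem continuous {M : ℕ} {g : mixedSpace K → ℝ} (hg : IsMomentKernelGE K M g) : Continuous g :=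
  hg.contDiff.continuous

/-- Weakening of the order. [folklore] -/
theorem mono {M M' : ℕ} {g : mixedSpace K → ℝ} (hM : M' ≤ M) (hg : IsMomentKernelGE K M g) : IsMomentKernelGE K M' g := by
  obtain ⟨k, hk, hgk⟩ := hg
  exact ⟨k, fun w => hM.trans (hk w), hgk⟩

/-- The zero kernel. [folklore] -/
theorem zero (M : ℕ) : IsMomentKernelGE K M (0 : mixedSpace K → ℝ) := ⟨fun _ => M, fun _ => le_rfl, IsMomentKernel.zero _⟩

/-- Sums. [folklore] -/
theorem add {M : ℕ} {g g' : mixedSpace K → ℝ} (hg : IsMomentKernelGE K M g) (hg' : IsMomentKernelGE K M g') :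
    IsMomentKernelGE K M (g + g') := by
  obtain ⟨k, hk, hgk⟩ := hg
  obtain ⟨k', hk', hgk'⟩ := hg'
  exact ⟨k ⊓ k', fun w => le_inf (hk w) (hk' w), (hgk.mono inf_le_left).add (hgk'.mono inf_le_right)⟩

/-- Scalar multiples. [folklore] -/
theorem smul {M : ℕ} {g : mixedSpace K → ℝ} (a : ℝ) (hg : IsMomentKernelGE K M g) : IsMomentKernelGE K M (a • g) := by
  obtain ⟨k, hk, hgk⟩ := hg
  exact ⟨k, hk, hgk.smul a⟩

/-- Scalar multiples, pointwise form. [folklore] -/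
theorem const_mul {M : ℕ} {g : mixedSpace K → ℝ} (a : ℝ) (hg : IsMomentKernelGE K M g) :
    IsMomentKernelGE K M (fun x => a * g x) :=
  hg.smul a

/-- Negation. [folklore] -/
theorem neg {M : ℕ} {g : mixedSpace K → ℝ} (hg : IsMomentKernelGE K M g) : IsMomentKernelGE K M (-g) := by
  obtain ⟨k, hk, hgk⟩ := hg
  exact ⟨k, hk, hgk.neg⟩

/-- Negation, pointwise form. [folklore] -/
theorem neg' {M : ℕ} {g : mixedSpace K → ℝ} (hg : IsMomentKernelGE K M g) : IsMomentKernelGE K M (fun x => -g x) :=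
  hg.neg

/-- Finite sums. [folklore] -/
theorem sum {M : ℕ} {ι' : Type*} (s : Finset ι') {g : ι' → mixedSpace K → ℝ}
    (hg : ∀ i ∈ s, IsMomentKernelGE K M (g i)) : IsMomentKernelGE K M (∑ i ∈ s, g i) := by
  induction s using Finset.induction_on with
  | empty => simpa using IsMomentKernelGE.zero M
  | insert i s hi ih =>
    rw [Finset.sum_insert hi]
    exact (hg i (Finset.mem_insert_self i s)).add (ih fun j hj => hg j (Finset.mem_insert_of_mem hj))

/-- **Directional derivatives keep the order.** [folklore] -/
theorem fderiv_dir {M : ℕ} {g : mixedSpace K → ℝ} (hg : IsMomentKernelGE K M g) (c : mixedSpace K) :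
    IsMomentKernelGE K M (fun x => fderiv ℝ g x c) := by
  obtain ⟨k, hk, hgk⟩ := hg
  exact ⟨k, hk, hgk.fderiv_dir c⟩

/-- **Multiplication by a real coordinate lowers the order by one.** [folklore] -/
theorem coord_mul {M : ℕ} {g : mixedSpace K → ℝ} (hg : IsMomentKernelGE K (M + 1) g) (b : index K) :
    IsMomentKernelGE K M (fun x => (stdBasis K).repr x b * g x) := by
  obtain ⟨k, hk, hgk⟩ := hg
  refine ⟨_, fun w => ?_, hgk.coord_mul b⟩
  by_cases hw : w = indexPlace K b
  · subst hw
    rw [Function.update_self]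
    exact Nat.le_sub_one_of_lt (hk _)
  · rw [Function.update_of_ne hw]
    exact (Nat.le_succ M).trans (hk w)

/-- Multiplication by a product of two real coordinates lowers the order by two. [folklore] -/
theorem coord_mul_coord_mul {M : ℕ} {g : mixedSpace K → ℝ} (hg : IsMomentKernelGE K (M + 2) g) (b b' : index K) :
    IsMomentKernelGE K M (fun x => (stdBasis K).repr x b * (stdBasis K).repr x b' * g x) := by
  have h := (hg.coord_mul b').coord_mul b
  simpa only [mul_assoc] using h

end IsMomentKernelGE

end Literature.NumberTheory.Automorphic
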